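import Literature.NumberTheory.Rogawski1990.LocalTransferExplicitSplit
import Literature.NumberTheory.Rogawski1990.SmoothTransferSplitPlaceGSideExplicit
import Literature.NumberTheory.Rogawski1990.GlobalAPacketMembership
import Literature.NumberTheory.Automorphic.UnitaryGroupConstantTermSplit
import Literature.NumberTheory.Automorphic.GLnParabolicRootDeltaBoxAd
import Literature.NumberTheory.Automorphic.GodementHeightFloor
import HarnessLib

/-!
# [Rogawski1990, Lemma 4.13.1 (a)] BY NAME: at a split place the named function `τ_v · f̄^P` (★ `UnitaryGroup.cmSplitTransfer`) is a test function
# and a `Δ‴_v`-transfer of `f` for every canonical pair of orbital measure families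

Topic `NumberTheory/Rogawski1990`; namespace `Literature.NumberTheory.Rogawski1990`.  THEOREMS ONLY (no definition, no instance, no notation, no named
fact, no `sorry`).  Cell `pub/hodgecm-mathlib`, line «CMCharIdentityTest» ED. 5 (F0P3b desk), stub (a) **`stub_splitTransferIsTransfer`**: the typer file ★
`UnitaryGroupConstantTermSplit` NAMED the split-place transfer `f ↦ (νG(K′)∕νH(K_H)) · μ_w(det (e₂ h.1)) · f̄^P(h)` that ★ B5-A PART 2 (b)
`isLocalDeltaTransferExists_finExplicit_of_split` had produced under an `∃` with the Iwasawa constant sealed.  This file re-runs that assembly with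
the constant THREADED (★ F1 `integral_descConj_quotientMeasure_eq_smul_integral_levi_of_eq_smul_map`, ★ F2
`classOrbitalIntegral_eq_smul_orbitalIntegral_levi_of_split_of_eq_smul_map`, the constant obtained from ★ `exists_quotientMeasure_levi_eq_smul_map_bool`
and identified with `νG(K′)∕νH(K_H)` by ★ `coe_mul_measure_eq_of_quotientMeasure_eq_smul_map` at `κ(K) = μ_U(U ∩ K) = 1`), and bridges the two
spellings: the named object lives at the parabolic `Zelevinsky1980.lastBlockLabel 3` of ★ `splitMemberGL`, the orbital files at `i ↦ [2 ≤ i]`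
(★ `UnitaryGroup.lastBlockLabel_three_eq`); `δ_P^{1∕2} = ‖det K‖^{1∕2}` is ★ `rootDeltaChar_standardParabolicGL_eq_sqrt_normAbs_det_boxAd`.
* §0 two `subst`-transports across equal block labellings (box determinant; the `K × U` integral).
* §1 **`isLocalDeltaTransfer_cmSplitTransfer`** — B5's frame (`hc … hH′w hΦ₂′ … hD1d`, `μ hl hr hdual`, Haar `νH νG`, canonical `mH mG`) + the two
  hypotheses of the named object (`hH′c : ᵗ(c̄ H′) = H′` in the `cmConjRingHom` spelling, `hH′d : IsUnit (det H′)`) + `f ∈ C_c^∞(G′_v)`: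
  `IsLocSmooth (cmSplitTransfer … f) ∧ IsLocalDeltaTransfer L H′ v (Δ‴ v) mH mG (cmSplitTransfer … f) f`.  Proof = ★ B5 PART 2 (b) verbatim around the
  BRIDGE `cmSplitTransfer … f = (h ↦ ψ (jj h) · gφ f (jj h))` (B5's weight `ψ = C · τ · ‖det K‖^{1∕2}` and constant term `gφ`, `C` now explicit).
* §2 **`splitTransferIsTransfer`** — the closed statement in the EXACT frame of the registered stub (every side condition discharged as in ★
  `localTransferExplicit_splitHalf`: `hdual` from `hμω`, `hl hr := finExplicitDelta_conj_left∕right_all`, `Φ₂ ∕ Φ₁` hermitian and units), for the desk's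
  one-hunk fold BY NAME.
HONEST LABEL: HC_CM is proved only modulo the printed citations (2 remaining named inputs hLiu418, h413) until rung 0 closes; this file is an in-house
re-run (count-neutral) and discharges none of them.

## References
* [Rogawski1990] J. D. Rogawski, *Automorphic Representations of Unitary Groups in Three Variables*, Ann. of Math. Stud. 123 (1990), §4.9 Prop. 4.9.1 (a)
  pp. 54–55; §4.13 Lemma 4.13.1 (a) pp. 64–66; §4.3 (4.3.1) p. 43; §4.4 p. 44.
* [LanglandsShelstad1987] R. P. Langlands, D. Shelstad, *On the definition of transfer factors*, Math. Ann. 278 (1987), §1.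
* [DeitmarEchterhoff2014] A. Deitmar, S. Echterhoff, *Principles of Harmonic Analysis*, 2nd ed. (2014), Thm. 1.5.3.
-/

set_option autoImplicit false

noncomputable section

open NumberField IsDedekindDomain MeasureTheory Measure TopologicalSpace
open scoped Matrix MatrixGroups NNReal ENNReal

namespace Literature.NumberTheory.Rogawski1990

open Literature.NumberTheory.Automorphic Literature.NumberTheory.GaloisRepresentations
open Literature.NumberTheory.GaloisRepresentations.IsNonarchimedeanLocalField
open Literature.MeasureTheory.Group Set Filter Topology
open Literature.NumberTheory.Automorphic.UnitaryGroup

/-! ## §0 `‖·‖ = normAbs` on `K_v`; transport across equal block labellings -/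

section Bridge

variable {K : Type} [Field K] [NumberField K]

/-- Mathlib's norm on `K_v` is the normalised absolute value `normAbs` of the local field `K_v` (★ `SmoothTransferSplitPlace`'s private bridge,
reproduced). [cite: TateThesis1967, §2.1] -/
private theorem norm_eq_coe_normAbs_adicCompletion' (v : HeightOneSpectrum (𝓞 K)) (x : v.adicCompletion K) :
    ‖x‖ = ((normAbs (v.adicCompletion K) x : ℝ≥0) : ℝ) := by
  by_cases hx : x = 0
  · rw [hx, norm_zero, map_zero, NNReal.coe_zero]
  have hv : Valued.v x ≠ 0 := (Valuation.ne_zero_iff _).2 hx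
  have hxn : Valued.v x = WithZero.exp (Multiplicative.toAdd (WithZero.unzero hv)) := by
    rw [WithZero.exp, ofAdd_toAdd, WithZero.coe_unzero]
  rw [FinitePlace.norm_def, WithZeroMulInt.toNNReal_neg_apply _ hv,
    normAbs_eq_inv_zpow_of_valued_eq v hxn, residueFieldCard_adicCompletion_eq, inv_zpow', neg_neg]
  rfl

end Bridge

section Label

variable (F : Type) [Field F] [ValuativeRel F] [TopologicalSpace F] [IsNonarchimedeanLocalField F]

/-- The box determinant `‖det (G_{ii′} G′_{j′j})_{(i,j′)}‖` depends on the labelling `c` only through its graph: transport along `c = c′`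
(`subst`). [cite: BernsteinZelevinsky1977, 1.7] -/
theorem normAbs_det_box_eq_of_label {c c' : Fin 3 → Bool} (h : c = c') (G G' : Matrix (Fin 3) (Fin 3) F) :
    normAbs F (Matrix.of fun q q' : {i : Fin 3 // c i = false} × {j : Fin 3 // c j = true} => G q.1 q'.1 * G' q'.2 q.2).det =
      normAbs F (Matrix.of fun q q' : {i : Fin 3 // c' i = false} × {j : Fin 3 // c' j = true} => G q.1 q'.1 * G' q'.2 q.2).det := by
  subst h
  rfl

/-- The `K × U_c`-average `∫ Φ(k (g u) k⁻¹)` against THE normalised Haar measures (`κ(K) = 1`, `μ_U(U_c ∩ K) = 1`) depends on the labelling `c` only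
through its graph: transport along `c = c′` (`subst`). [cite: Rogawski1990, §4.13 p. 64] -/
theorem integral_KU_eq_of_label {c c' : Fin 3 → Bool} (h : c = c') (Φ : GL (Fin 3) F → ℂ) (g : GL (Fin 3) F) :
    (letI : MeasurableSpace (GL (Fin 3) F) := borel _
     haveI : BorelSpace (GL (Fin 3) F) := ⟨rfl⟩
     ∫ q : ↥(glInt 3 F) × ↥(unipotentRadicalGL F c), Φ ((q.1 : GL (Fin 3) F) * (g * (q.2 : GL (Fin 3) F)) * (q.1 : GL (Fin 3) F)⁻¹)
       ∂((haarMeasure (UnitaryGroup.glIntPositiveCompacts F)).prod (haarMeasure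
          (⟨⟨((↑) : ↥(unipotentRadicalGL F c) → GL (Fin 3) F) ⁻¹' (glInt 3 F : Set (GL (Fin 3) F)),
            haveI := (isLocalField F).toT2Space
            (isClosed_unipotentRadicalGL (R := F) c).isClosedEmbedding_subtypeVal.isCompact_preimage (isCompact_glInt (n := 3) (F := F))⟩,
            ⟨1, ((isOpen_glInt (n := 3) (F := F)).preimage continuous_subtype_val).interior_eq.symm ▸ (glInt 3 F).one_mem⟩⟩ :
            PositiveCompacts ↥(unipotentRadicalGL F c))))) =
    (letI : MeasurableSpace (GL (Fin 3) F) := borel _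
     haveI : BorelSpace (GL (Fin 3) F) := ⟨rfl⟩
     ∫ q : ↥(glInt 3 F) × ↥(unipotentRadicalGL F c'), Φ ((q.1 : GL (Fin 3) F) * (g * (q.2 : GL (Fin 3) F)) * (q.1 : GL (Fin 3) F)⁻¹)
       ∂((haarMeasure (UnitaryGroup.glIntPositiveCompacts F)).prod (haarMeasure
          (⟨⟨((↑) : ↥(unipotentRadicalGL F c') → GL (Fin 3) F) ⁻¹' (glInt 3 F : Set (GL (Fin 3) F)),
            haveI := (isLocalField F).toT2Space
            (isClosed_unipotentRadicalGL (R := F) c').isClosedEmbedding_subtypeVal.isCompact_preimage (isCompact_glInt (n := 3) (F := F))⟩,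
            ⟨1, ((isOpen_glInt (n := 3) (F := F)).preimage continuous_subtype_val).interior_eq.symm ▸ (glInt 3 F).one_mem⟩⟩ :
            PositiveCompacts ↥(unipotentRadicalGL F c'))))) := by
  subst h
  rfl

end Label

/-! ## §1 The named transfer at a split place: test function and `Δ‴_v`-transfer -/

section Named

variable (L : Type) [Field L] [NumberField L] [IsCMField L] (H' : Matrix (Fin 3) (Fin 3) L)
  {v : HeightOneSpectrum (𝓞 ↥(maximalRealSubfield L))} (hc : IsCMField.complexConj L ≠ 1)
  (w : UnitaryGroup.PlacesOver L v) (hw : IsCMField.complexConj L • w.1 ≠ w.1)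
  (hΦ₂ : ((Matrix.of fun i j : Fin 2 => if i.val + j.val + 1 = 2 then (1 : L) else 0).map (IsCMField.complexConj L))ᵀ =
    Matrix.of fun i j : Fin 2 => if i.val + j.val + 1 = 2 then (1 : L) else 0)
  (hΦ₂w : IsUnit (placeForm (Matrix.of fun i j : Fin 2 => if i.val + j.val + 1 = 2 then (1 : L) else 0) w.1))
  (hΦ₁ : ((Matrix.of fun i j : Fin 1 => if i.val + j.val + 1 = 1 then (1 : L) else 0).map (IsCMField.complexConj L))ᵀ =
    Matrix.of fun i j : Fin 1 => if i.val + j.val + 1 = 1 then (1 : L) else 0)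
  (hΦ₁w : IsUnit (placeForm (Matrix.of fun i j : Fin 1 => if i.val + j.val + 1 = 1 then (1 : L) else 0) w.1))
  (hH' : (H'.map (IsCMField.complexConj L))ᵀ = H') (hH'w : IsUnit (placeForm H' w.1))


include hc hw hΦ₂ hΦ₂w hΦ₁ hΦ₁w hH' hH'w in
set_option maxHeartbeats 1600000 in
/-- **[Rogawski1990, Prop. 4.9.1 (a) ∕ Lemma 4.13.1 (a)] BY NAME — `τ_v · f̄^P` IS A TEST FUNCTION AND A `Δ‴_v`-TRANSFER OF `f`** at a place `v` of `L⁺`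
split in `L`, for CANONICAL orbital measure families and ARBITRARY Haar measures `νH`, `νG`: for every `f ∈ C_c^∞(U(H′)(L⁺_v))` the named function ★
`UnitaryGroup.cmSplitTransfer L H′ hH′c hH′d v w hw μ νH νG f = (h ↦ (νG(K′)∕νH(K_H)) · μ_w(det (e₂ h.1)) · f̄^P(h))` is locally constant with compact support
and satisfies `Φ^{st}(γ_H, ·) = Σ_{[γ]} Δ‴_v(γ_H, γ) Φ([γ], f)` at every `G`-regular `γ_H` (★ `IsLocalDeltaTransfer` at ★ `finExplicitCollection`).  Assembly = ★
B5-A PART 2 (b) with the Iwasawa constant `C` of `(e′_* νG)∕(jj_* νH) = C • π_*(κ ⊗ μ_U)` EXPLICIT (★ `exists_quotientMeasure_levi_eq_smul_map_bool`; ★ F2 for the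
`G`-side; `C = νG(K′)∕νH(K_H)` by ★ `coe_mul_measure_eq_of_quotientMeasure_eq_smul_map`, `κ(K) = μ_U(U ∩ K) = 1`), around the BRIDGE
`cmSplitTransfer … f = (h ↦ ψ (jj h) · gφ f (jj h))`.
[cite: Rogawski1990, §4.9 Prop. 4.9.1 (a) pp. 54–55; §4.13 Lemma 4.13.1 (a) pp. 64–66; §4.3 (4.3.1) p. 43; §4.4 p. 44] [cite: LanglandsShelstad1987, §1] -/
theorem isLocalDeltaTransfer_cmSplitTransfer
    (hΦ₂' : ((Matrix.of fun i j : Fin 2 => if i.val + j.val + 1 = 2 then (1 : L) else 0).map (cmConjRingHom L))ᵀ =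
      Matrix.of fun i j : Fin 2 => if i.val + j.val + 1 = 2 then (1 : L) else 0)
    (hΦ₂d : (Matrix.of fun i j : Fin 2 => if i.val + j.val + 1 = 2 then (1 : L) else 0).det ≠ 0)
    (hΦ₁' : ((Matrix.of fun i j : Fin 1 => if i.val + j.val + 1 = 1 then (1 : L) else 0).map (cmConjRingHom L))ᵀ =
      Matrix.of fun i j : Fin 1 => if i.val + j.val + 1 = 1 then (1 : L) else 0)
    (hΦ₁d : (Matrix.of fun i j : Fin 1 => if i.val + j.val + 1 = 1 then (1 : L) else 0).det ≠ 0)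
    [MeasurableSpace (w.1.adicCompletion L)] [BorelSpace (w.1.adicCompletion L)]
    [MeasurableSpace ((UnitaryGroup.cmDatum L 2 (Matrix.of fun i j : Fin 2 => if i.val + j.val + 1 = 2 then (1 : L) else 0)).Local v ×
        (UnitaryGroup.cmDatum L 1 (Matrix.of fun i j : Fin 1 => if i.val + j.val + 1 = 1 then (1 : L) else 0)).Local v)]
    [BorelSpace ((UnitaryGroup.cmDatum L 2 (Matrix.of fun i j : Fin 2 => if i.val + j.val + 1 = 2 then (1 : L) else 0)).Local v ×
        (UnitaryGroup.cmDatum L 1 (Matrix.of fun i j : Fin 1 => if i.val + j.val + 1 = 1 then (1 : L) else 0)).Local v)]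
    [MeasurableSpace ((UnitaryGroup.cmDatum L 3 H').Local v)] [BorelSpace ((UnitaryGroup.cmDatum L 3 H').Local v)]
    [∀ a : ((UnitaryGroup.cmDatum L 2 (Matrix.of fun i j : Fin 2 => if i.val + j.val + 1 = 2 then (1 : L) else 0)).Local v ×
        (UnitaryGroup.cmDatum L 1 (Matrix.of fun i j : Fin 1 => if i.val + j.val + 1 = 1 then (1 : L) else 0)).Local v),
      MeasurableSpace (((UnitaryGroup.cmDatum L 2 (Matrix.of fun i j : Fin 2 => if i.val + j.val + 1 = 2 then (1 : L) else 0)).Local v ×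
        (UnitaryGroup.cmDatum L 1 (Matrix.of fun i j : Fin 1 => if i.val + j.val + 1 = 1 then (1 : L) else 0)).Local v) ⧸
        Subgroup.centralizer ({a} : Set ((UnitaryGroup.cmDatum L 2 (Matrix.of fun i j : Fin 2 => if i.val + j.val + 1 = 2 then (1 : L) else 0)).Local v ×
        (UnitaryGroup.cmDatum L 1 (Matrix.of fun i j : Fin 1 => if i.val + j.val + 1 = 1 then (1 : L) else 0)).Local v)))]
    [∀ a : ((UnitaryGroup.cmDatum L 2 (Matrix.of fun i j : Fin 2 => if i.val + j.val + 1 = 2 then (1 : L) else 0)).Local v ×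
        (UnitaryGroup.cmDatum L 1 (Matrix.of fun i j : Fin 1 => if i.val + j.val + 1 = 1 then (1 : L) else 0)).Local v),
      BorelSpace (((UnitaryGroup.cmDatum L 2 (Matrix.of fun i j : Fin 2 => if i.val + j.val + 1 = 2 then (1 : L) else 0)).Local v ×
        (UnitaryGroup.cmDatum L 1 (Matrix.of fun i j : Fin 1 => if i.val + j.val + 1 = 1 then (1 : L) else 0)).Local v) ⧸
        Subgroup.centralizer ({a} : Set ((UnitaryGroup.cmDatum L 2 (Matrix.of fun i j : Fin 2 => if i.val + j.val + 1 = 2 then (1 : L) else 0)).Local v ×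
        (UnitaryGroup.cmDatum L 1 (Matrix.of fun i j : Fin 1 => if i.val + j.val + 1 = 1 then (1 : L) else 0)).Local v)))]
    [∀ γ : (UnitaryGroup.cmDatum L 3 H').Local v,
      MeasurableSpace ((UnitaryGroup.cmDatum L 3 H').Local v ⧸ Subgroup.centralizer ({γ} : Set ((UnitaryGroup.cmDatum L 3 H').Local v)))]
    [∀ γ : (UnitaryGroup.cmDatum L 3 H').Local v,
      BorelSpace ((UnitaryGroup.cmDatum L 3 H').Local v ⧸ Subgroup.centralizer ({γ} : Set ((UnitaryGroup.cmDatum L 3 H').Local v)))]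
    (μ : HeckeCharacter L)
    (hl : ∀ (v : HeightOneSpectrum (𝓞 ↥(maximalRealSubfield L)))
      (a : (UnitaryGroup.cmDatum L 2 (Matrix.of fun i j : Fin 2 => if i.val + j.val + 1 = 2 then (1 : L) else 0)).Local v ×
      (UnitaryGroup.cmDatum L 1 (Matrix.of fun i j : Fin 1 => if i.val + j.val + 1 = 1 then (1 : L) else 0)).Local v)
      (b : (UnitaryGroup.cmDatum L 3 H').Local v)
      (x : (UnitaryGroup.cmDatum L 2 (Matrix.of fun i j : Fin 2 => if i.val + j.val + 1 = 2 then (1 : L) else 0)).Local v ×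
      (UnitaryGroup.cmDatum L 1 (Matrix.of fun i j : Fin 1 => if i.val + j.val + 1 = 1 then (1 : L) else 0)).Local v),
      finExplicitDelta L v H' (x * a * x⁻¹) μ b = finExplicitDelta L v H' a μ b)
    (hr : ∀ (v : HeightOneSpectrum (𝓞 ↥(maximalRealSubfield L)))
      (a : (UnitaryGroup.cmDatum L 2 (Matrix.of fun i j : Fin 2 => if i.val + j.val + 1 = 2 then (1 : L) else 0)).Local v ×
      (UnitaryGroup.cmDatum L 1 (Matrix.of fun i j : Fin 1 => if i.val + j.val + 1 = 1 then (1 : L) else 0)).Local v)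
      (b y : (UnitaryGroup.cmDatum L 3 H').Local v),
      finExplicitDelta L v H' a μ (y * b * y⁻¹) = finExplicitDelta L v H' a μ b)
    (hdual : HeckeCharacter.galConj (IsCMField.complexConj L) μ = μ⁻¹)
    (νH : Measure ((UnitaryGroup.cmDatum L 2 (Matrix.of fun i j : Fin 2 => if i.val + j.val + 1 = 2 then (1 : L) else 0)).Local v ×
        (UnitaryGroup.cmDatum L 1 (Matrix.of fun i j : Fin 1 => if i.val + j.val + 1 = 1 then (1 : L) else 0)).Local v))
    [νH.IsHaarMeasure] [νH.IsMulRightInvariant]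
    (νG : Measure ((UnitaryGroup.cmDatum L 3 H').Local v)) [νG.IsHaarMeasure] [νG.IsMulRightInvariant]
    (mH : OrbitalMeasureFamily ((UnitaryGroup.cmDatum L 2 (Matrix.of fun i j : Fin 2 => if i.val + j.val + 1 = 2 then (1 : L) else 0)).Local v ×
        (UnitaryGroup.cmDatum L 1 (Matrix.of fun i j : Fin 1 => if i.val + j.val + 1 = 1 then (1 : L) else 0)).Local v))
    (mG : OrbitalMeasureFamily ((UnitaryGroup.cmDatum L 3 H').Local v))
    (hcanH : mH.IsCanonical (IsLocalGRegular L v) νH)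
    (hcanG : mG.IsCanonical (fun γ : (UnitaryGroup.cmDatum L 3 H').Local v => IsRegularElt (γ.val : GL (Fin 3) (UnitaryGroup.LocalRing L v))) νG)
    (hH'c : (H'.map (cmConjRingHom L))ᵀ = H') (hH'd : IsUnit H'.det)
    (f : (UnitaryGroup.cmDatum L 3 H').Local v → ℂ) (hf : IsLocSmooth f) :
    IsLocSmooth (UnitaryGroup.cmSplitTransfer L H' hH'c hH'd v w hw μ νH νG f) ∧
      IsLocalDeltaTransfer L H' v (finExplicitCollection L H' μ hl hr v) mH mG (UnitaryGroup.cmSplitTransfer L H' hH'c hH'd v w hw μ νH νG f) f := by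
  -- (0) the `G′_v` carrier under its `«local»` name (★ `cmDatum_Local`, definitional) for the instance binders of ★ B5-R
  letI : MeasurableSpace ↥(«local» L (IsCMField.complexConj L) 3 H' v) := ‹MeasurableSpace ((UnitaryGroup.cmDatum L 3 H').Local v)›
  haveI : @BorelSpace ↥(«local» L (IsCMField.complexConj L) 3 H' v) _ ‹MeasurableSpace ((UnitaryGroup.cmDatum L 3 H').Local v)› :=
    ‹BorelSpace ((UnitaryGroup.cmDatum L 3 H').Local v)›
  letI : ∀ γ : ↥(«local» L (IsCMField.complexConj L) 3 H' v),
      MeasurableSpace (↥(«local» L (IsCMField.complexConj L) 3 H' v) ⧸ Subgroup.centralizer ({γ} : Set ↥(«local» L (IsCMField.complexConj L) 3 H' v))) :=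
    ‹∀ γ : (UnitaryGroup.cmDatum L 3 H').Local v,
      MeasurableSpace ((UnitaryGroup.cmDatum L 3 H').Local v ⧸ Subgroup.centralizer ({γ} : Set ((UnitaryGroup.cmDatum L 3 H').Local v)))›
  haveI : ∀ γ : ↥(«local» L (IsCMField.complexConj L) 3 H' v),
      @BorelSpace (↥(«local» L (IsCMField.complexConj L) 3 H' v) ⧸ Subgroup.centralizer ({γ} : Set ↥(«local» L (IsCMField.complexConj L) 3 H' v))) _
        (‹∀ γ : (UnitaryGroup.cmDatum L 3 H').Local v,
          MeasurableSpace ((UnitaryGroup.cmDatum L 3 H').Local v ⧸ Subgroup.centralizer ({γ} : Set ((UnitaryGroup.cmDatum L 3 H').Local v)))› γ) :=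
    ‹∀ γ : (UnitaryGroup.cmDatum L 3 H').Local v,
      BorelSpace ((UnitaryGroup.cmDatum L 3 H').Local v ⧸ Subgroup.centralizer ({γ} : Set ((UnitaryGroup.cmDatum L 3 H').Local v)))›
  haveI : (show Measure ↥(«local» L (IsCMField.complexConj L) 3 H' v) from νG).IsHaarMeasure := ‹νG.IsHaarMeasure›
  haveI : (show Measure ↥(«local» L (IsCMField.complexConj L) 3 H' v) from νG).IsMulRightInvariant := ‹νG.IsMulRightInvariant›
  -- (0) instances on `GL₃(L_w)`, the Levi `M`, `K`, `U`
  letI : MeasurableSpace (GL (Fin (2 + 1)) (w.1.adicCompletion L)) := borel _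
  haveI : BorelSpace (GL (Fin (2 + 1)) (w.1.adicCompletion L)) := ⟨rfl⟩
  haveI : LocallyCompactSpace (GL (Fin (2 + 1)) (w.1.adicCompletion L)) := locallyCompactSpace_gl_adicCompletion L (2 + 1) w.1
  haveI : SecondCountableTopology (GL (Fin (2 + 1)) (w.1.adicCompletion L)) := secondCountableTopology_gl_adicCompletion L (2 + 1) w.1
  have hMc : IsClosed ((standardLeviGL (w.1.adicCompletion L) (fun i : Fin (2 + 1) => decide (2 ≤ (i : ℕ))) :
      Subgroup (GL (Fin (2 + 1)) (w.1.adicCompletion L))) : Set (GL (Fin (2 + 1)) (w.1.adicCompletion L))) :=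
    isClosed_standardLeviGL (R := w.1.adicCompletion L) _
  haveI : LocallyCompactSpace ↥(standardLeviGL (w.1.adicCompletion L) (fun i : Fin (2 + 1) => decide (2 ≤ (i : ℕ)))) :=
    hMc.isClosedEmbedding_subtypeVal.locallyCompactSpace
  haveI : BorelSpace ↥(standardLeviGL (w.1.adicCompletion L) (fun i : Fin (2 + 1) => decide (2 ≤ (i : ℕ)))) := Subtype.borelSpace _
  letI : MeasurableSpace (GL (Fin (2 + 1)) (w.1.adicCompletion L) ⧸ standardLeviGL (w.1.adicCompletion L) (fun i : Fin (2 + 1) => decide (2 ≤ (i : ℕ)))) :=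
    borel _
  haveI : BorelSpace (GL (Fin (2 + 1)) (w.1.adicCompletion L) ⧸ standardLeviGL (w.1.adicCompletion L) (fun i : Fin (2 + 1) => decide (2 ≤ (i : ℕ)))) := ⟨rfl⟩
  letI : ∀ m : ↥(standardLeviGL (w.1.adicCompletion L) (fun i : Fin (2 + 1) => decide (2 ≤ (i : ℕ)))),
      MeasurableSpace (↥(standardLeviGL (w.1.adicCompletion L) (fun i : Fin (2 + 1) => decide (2 ≤ (i : ℕ)))) ⧸
        Subgroup.centralizer ({m} : Set ↥(standardLeviGL (w.1.adicCompletion L) (fun i : Fin (2 + 1) => decide (2 ≤ (i : ℕ)))))) :=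
    fun _ => borel _
  haveI : ∀ m : ↥(standardLeviGL (w.1.adicCompletion L) (fun i : Fin (2 + 1) => decide (2 ≤ (i : ℕ)))),
      BorelSpace (↥(standardLeviGL (w.1.adicCompletion L) (fun i : Fin (2 + 1) => decide (2 ≤ (i : ℕ)))) ⧸
        Subgroup.centralizer ({m} : Set ↥(standardLeviGL (w.1.adicCompletion L) (fun i : Fin (2 + 1) => decide (2 ≤ (i : ℕ)))))) :=
    fun _ => ⟨rfl⟩
  haveI : BorelSpace ↥(glInt (2 + 1) (w.1.adicCompletion L)) := Subtype.borelSpace _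
  haveI : CompactSpace ↥(glInt (2 + 1) (w.1.adicCompletion L)) := isCompact_iff_compactSpace.1 (isCompact_glInt (2 + 1) (w.1.adicCompletion L))
  haveI : BorelSpace ↥(unipotentRadicalGL (w.1.adicCompletion L) (fun i : Fin (2 + 1) => decide (2 ≤ (i : ℕ)))) := Subtype.borelSpace _
  haveI : LocallyCompactSpace ↥(unipotentRadicalGL (w.1.adicCompletion L) (fun i : Fin (2 + 1) => decide (2 ≤ (i : ℕ)))) :=
    (isClosed_unipotentRadicalGL (R := w.1.adicCompletion L) (fun i : Fin (2 + 1) => decide (2 ≤ (i : ℕ)))).isClosedEmbedding_subtypeVal.locallyCompactSpace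
  haveI : SecondCountableTopology ↥(unipotentRadicalGL (w.1.adicCompletion L) (fun i : Fin (2 + 1) => decide (2 ≤ (i : ℕ)))) :=
    TopologicalSpace.Subtype.secondCountableTopology _
  -- (0′) THE NORMALISED MEASURES of ★ `splitKUMeasure`: `κ(K) = 1`, `μ_U(U ∩ K) = 1` (kept opaque with their defining equations)
  obtain ⟨κ, hκ⟩ : ∃ κ : Measure ↥(glInt (2 + 1) (w.1.adicCompletion L)), κ = haarMeasure (UnitaryGroup.glIntPositiveCompacts (w.1.adicCompletion L)) := ⟨_, rfl⟩
  haveI : IsHaarMeasure κ := by rw [hκ]; exact isHaarMeasure_haarMeasure _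
  obtain ⟨μU, hμU⟩ : ∃ μU : Measure ↥(unipotentRadicalGL (w.1.adicCompletion L) (fun i : Fin (2 + 1) => decide (2 ≤ (i : ℕ)))),
      μU = haarMeasure (⟨⟨((↑) : ↥(unipotentRadicalGL (w.1.adicCompletion L) (fun i : Fin (2 + 1) => decide (2 ≤ (i : ℕ)))) →
          GL (Fin (2 + 1)) (w.1.adicCompletion L)) ⁻¹' (glInt (2 + 1) (w.1.adicCompletion L) : Set (GL (Fin (2 + 1)) (w.1.adicCompletion L))),
        (isClosed_unipotentRadicalGL (R := w.1.adicCompletion L) (fun i : Fin (2 + 1) => decide (2 ≤ (i : ℕ)))).isClosedEmbedding_subtypeVal.isCompact_preimage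
          (isCompact_glInt (n := 2 + 1) (F := w.1.adicCompletion L))⟩,
        ⟨1, ((isOpen_glInt (n := 2 + 1) (F := w.1.adicCompletion L)).preimage continuous_subtype_val).interior_eq.symm ▸
          (glInt (2 + 1) (w.1.adicCompletion L)).one_mem⟩⟩ : PositiveCompacts ↥(unipotentRadicalGL (w.1.adicCompletion L) (fun i : Fin (2 + 1) => decide (2 ≤ (i : ℕ))))) :=
    ⟨_, rfl⟩
  haveI : IsHaarMeasure μU := by rw [hμU]; exact isHaarMeasure_haarMeasure _
  haveI : SFinite μU := inferInstance
  have hκ1 : κ Set.univ = 1 := by rw [hκ]; exact haarMeasure_self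
  have hμU1 : μU {u | (u : GL (Fin (2 + 1)) (w.1.adicCompletion L)) ∈ glInt (2 + 1) (w.1.adicCompletion L)} = 1 := by rw [hμU]; exact haarMeasure_self
  -- (1) the frames `e′`, `e₂`, `e₁`, `eM` (kept OPAQUE with their defining equations) and `j̃ : H_v ≃ₜ* M`
  obtain ⟨e', he'⟩ : ∃ e' : ↥(«local» L (IsCMField.complexConj L) 3 H' v) ≃ₜ* GL (Fin 3) (w.1.adicCompletion L),
      e' = localSplitEquiv (IsCMField.complexConj L) H' hc hH' w hw hH'w := ⟨_, rfl⟩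
  have he'D : e' = localSplitEquiv (IsCMField.complexConj L) H' (IsCMField.complexConj_ne_one L)
      ((UnitaryGroup.map_cmConjRingHom_eq_map_complexConj L H') ▸ hH'c) w hw (UnitaryGroup.isUnit_placeForm_of_isUnit_det hH'd w.1) := he'
  obtain ⟨e₂, he₂⟩ : ∃ e₂ : ↥(«local» L (IsCMField.complexConj L) 2 (Matrix.of fun i j : Fin 2 => if i.val + j.val + 1 = 2 then (1 : L) else 0) v) ≃ₜ*
      GL (Fin 2) (w.1.adicCompletion L),
      e₂ = localSplitEquiv (IsCMField.complexConj L) (Matrix.of fun i j : Fin 2 => if i.val + j.val + 1 = 2 then (1 : L) else 0) hc hΦ₂ w hw hΦ₂w :=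
    ⟨_, rfl⟩
  have he₂D : e₂ = UnitaryGroup.cmSplitEquivTwo L v w hw := he₂
  obtain ⟨e₁, he₁⟩ : ∃ e₁ : ↥(«local» L (IsCMField.complexConj L) 1 (Matrix.of fun i j : Fin 1 => if i.val + j.val + 1 = 1 then (1 : L) else 0) v) ≃ₜ*
      GL (Fin 1) (w.1.adicCompletion L),
      e₁ = localSplitEquiv (IsCMField.complexConj L) (Matrix.of fun i j : Fin 1 => if i.val + j.val + 1 = 1 then (1 : L) else 0) hc hΦ₁ w hw hΦ₁w :=
    ⟨_, rfl⟩
  have he₁D : e₁ = UnitaryGroup.cmSplitEquivOne L v w hw := he₁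
  obtain ⟨eM, heM⟩ := exists_continuousMulEquiv_prod_standardLeviGL_twoBlock (w.1.adicCompletion L) 2 1
  let jj : ((UnitaryGroup.cmDatum L 2 (Matrix.of fun i j : Fin 2 => if i.val + j.val + 1 = 2 then (1 : L) else 0)).Local v ×
        (UnitaryGroup.cmDatum L 1 (Matrix.of fun i j : Fin 1 => if i.val + j.val + 1 = 1 then (1 : L) else 0)).Local v) ≃ₜ*
      ↥(standardLeviGL (w.1.adicCompletion L) (fun i : Fin (2 + 1) => decide (2 ≤ (i : ℕ)))) :=
    { toMulEquiv := (MulEquiv.prodCongr e₂.toMulEquiv e₁.toMulEquiv).trans eM.toMulEquiv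
      continuous_toFun := eM.continuous.comp (e₂.continuous.prodMap e₁.continuous)
      continuous_invFun := (e₂.symm.continuous.prodMap e₁.symm.continuous).comp eM.symm.continuous }
  have hjj : ∀ x, jj x = eM (e₂ x.1, e₁ x.2) := fun _ => rfl
  -- (2) measures: `ν_M := j̃_* ν_H`
  haveI : νH.IsInvInvariant := isInvInvariant_of_isMulRightInvariant νH
  haveI : IsHaarMeasure (Measure.map jj νH) := jj.isHaarMeasure_map νH
  haveI : (Measure.map jj νH).IsMulRightInvariant :=
    isMulRightInvariant_map_mulEquiv_of_isMulRightInvariant jj.toMulEquiv jj.continuous.measurable νH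
  haveI : (Measure.map jj νH).IsInvInvariant := isInvInvariant_map_mulEquiv jj.toMulEquiv jj.continuous.measurable νH
  have hjjGL : ∀ x, ((jj x : ↥(standardLeviGL (w.1.adicCompletion L) (fun i : Fin (2 + 1) => decide (2 ≤ (i : ℕ))))) : GL (Fin (2 + 1)) (w.1.adicCompletion L)) =
      UnitaryGroup.cmSplitLeviGL L v w hw x := fun x => by
    rw [hjj, heM, UnitaryGroup.cmSplitLeviGL_apply, he₂D, he₁D]
    rfl
  -- (3) THE IWASAWA CONSTANT, EXPLICIT: `(e′_* νG)∕(jj_* νH) = C • π_*(κ ⊗ μ_U)` and `C · νH(K_H) = νG(K′)`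
  obtain ⟨νG', hνG'⟩ : ∃ νG' : Measure ↥(«local» L (IsCMField.complexConj L) 3 H' v), νG' = νG := ⟨_, rfl⟩
  haveI : IsHaarMeasure νG' := by rw [hνG']; exact ‹(show Measure ↥(«local» L (IsCMField.complexConj L) 3 H' v) from νG).IsHaarMeasure›
  haveI : νG'.IsMulRightInvariant := by rw [hνG']; exact ‹(show Measure ↥(«local» L (IsCMField.complexConj L) 3 H' v) from νG).IsMulRightInvariant›
  have hme : Measurable (⇑e' : ↥(«local» L (IsCMField.complexConj L) 3 H' v) → GL (Fin 3) (w.1.adicCompletion L)) := e'.continuous.measurable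
  have hmj : Measurable (⇑jj : ((UnitaryGroup.cmDatum L 2 (Matrix.of fun i j : Fin 2 => if i.val + j.val + 1 = 2 then (1 : L) else 0)).Local v ×
        (UnitaryGroup.cmDatum L 1 (Matrix.of fun i j : Fin 1 => if i.val + j.val + 1 = 1 then (1 : L) else 0)).Local v) →
      ↥(standardLeviGL (w.1.adicCompletion L) (fun i : Fin (2 + 1) => decide (2 ≤ (i : ℕ))))) := jj.continuous.measurable
  haveI : IsHaarMeasure (Measure.map e' νG') := e'.isHaarMeasure_map νG'
  haveI : (Measure.map e' νG').IsMulRightInvariant :=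
    isMulRightInvariant_map_mulEquiv_of_isMulRightInvariant e'.toMulEquiv hme νG'
  obtain ⟨C, -, hqC⟩ := exists_quotientMeasure_levi_eq_smul_map_bool (w.1.adicCompletion L) monotone_twoOneLabel
    (A := standardLeviGL (w.1.adicCompletion L) (fun i : Fin (2 + 1) => decide (2 ≤ (i : ℕ)))) rfl
    (quotientMeasure (standardLeviGL (w.1.adicCompletion L) (fun i : Fin (2 + 1) => decide (2 ≤ (i : ℕ)))) (Measure.map jj νH) hMc (Measure.map e' νG'))
    (quotientMeasure_ne_zero _ _ _ _) κ μU
  have hmass := coe_mul_measure_eq_of_quotientMeasure_eq_smul_map (w.1.adicCompletion L)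
    (A := standardLeviGL (w.1.adicCompletion L) (fun i : Fin (2 + 1) => decide (2 ≤ (i : ℕ)))) rfl hMc (Measure.map e' νG') (Measure.map jj νH) κ μU hqC
  rw [hκ1, hμU1, mul_one, mul_one] at hmass
  -- `νG(K′)` and `νH(K_H)` through the frames
  have hKG : (Measure.map e' νG') (glInt (2 + 1) (w.1.adicCompletion L) : Set (GL (Fin (2 + 1)) (w.1.adicCompletion L))) =
      νG (UnitaryGroup.cmSplitMaxCompact L v w hw H' hH'c hH'd) := by
    rw [Measure.map_apply hme (isOpen_glInt (n := 2 + 1) (F := w.1.adicCompletion L)).measurableSet, hνG', he'D]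
    rfl
  have hKH : (Measure.map jj νH) {a : ↥(standardLeviGL (w.1.adicCompletion L) (fun i : Fin (2 + 1) => decide (2 ≤ (i : ℕ)))) |
        (a : GL (Fin (2 + 1)) (w.1.adicCompletion L)) ∈ glInt (2 + 1) (w.1.adicCompletion L)} = νH (UnitaryGroup.cmSplitLeviCompact L v w hw) := by
    have hms : MeasurableSet {a : ↥(standardLeviGL (w.1.adicCompletion L) (fun i : Fin (2 + 1) => decide (2 ≤ (i : ℕ)))) |
        (a : GL (Fin (2 + 1)) (w.1.adicCompletion L)) ∈ glInt (2 + 1) (w.1.adicCompletion L)} :=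
      ((isOpen_glInt (n := 2 + 1) (F := w.1.adicCompletion L)).preimage continuous_subtype_val).measurableSet
    rw [Measure.map_apply hmj hms]
    congr 1
    ext x
    simp only [Set.mem_preimage, Set.mem_setOf_eq, hjjGL, SetLike.mem_coe, UnitaryGroup.mem_cmSplitLeviCompact_iff]
  rw [hKG, hKH] at hmass
  -- `K_H` is a compact open subgroup: `0 < νH(K_H) < ∞`
  have hKHset : (UnitaryGroup.cmSplitLeviCompact L v w hw : Set _) = jj ⁻¹' (((↑) : ↥(standardLeviGL (w.1.adicCompletion L) (fun i : Fin (2 + 1) => decide (2 ≤ (i : ℕ)))) →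
      GL (Fin (2 + 1)) (w.1.adicCompletion L)) ⁻¹' (glInt (2 + 1) (w.1.adicCompletion L) : Set (GL (Fin (2 + 1)) (w.1.adicCompletion L)))) := by
    ext x
    simp only [SetLike.mem_coe, UnitaryGroup.mem_cmSplitLeviCompact_iff, Set.mem_preimage, hjjGL]
  have hKH0 : νH (UnitaryGroup.cmSplitLeviCompact L v w hw) ≠ 0 := by
    have hopen : IsOpen ((UnitaryGroup.cmSplitLeviCompact L v w hw : Subgroup _) : Set
        ((UnitaryGroup.cmDatum L 2 (Matrix.of fun i j : Fin 2 => if i.val + j.val + 1 = 2 then (1 : L) else 0)).Local v ×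
          (UnitaryGroup.cmDatum L 1 (Matrix.of fun i j : Fin 1 => if i.val + j.val + 1 = 1 then (1 : L) else 0)).Local v)) := by
      rw [hKHset]
      exact ((isOpen_glInt (n := 2 + 1) (F := w.1.adicCompletion L)).preimage continuous_subtype_val).preimage jj.continuous
    exact (hopen.measure_pos νH ⟨1, (UnitaryGroup.cmSplitLeviCompact L v w hw).one_mem⟩).ne'
  have hKHt : νH (UnitaryGroup.cmSplitLeviCompact L v w hw) ≠ ⊤ := by
    have hcpt : IsCompact ((UnitaryGroup.cmSplitLeviCompact L v w hw : Subgroup _) : Set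
        ((UnitaryGroup.cmDatum L 2 (Matrix.of fun i j : Fin 2 => if i.val + j.val + 1 = 2 then (1 : L) else 0)).Local v ×
          (UnitaryGroup.cmDatum L 1 (Matrix.of fun i j : Fin 1 => if i.val + j.val + 1 = 1 then (1 : L) else 0)).Local v)) := by
      rw [hKHset]
      exact jj.toHomeomorph.isCompact_preimage.2 (hMc.isClosedEmbedding_subtypeVal.isCompact_preimage
        (isCompact_glInt (n := 2 + 1) (F := w.1.adicCompletion L)))
    exact hcpt.measure_lt_top.ne
  have hCreal : (((C : ℝ≥0∞)).toReal : ℝ) =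
      (νG (UnitaryGroup.cmSplitMaxCompact L v w hw H' hH'c hH'd)).toReal / (νH (UnitaryGroup.cmSplitLeviCompact L v w hw)).toReal := by
    rw [eq_div_iff (ENNReal.toReal_ne_zero.2 ⟨hKH0, hKHt⟩), ← ENNReal.toReal_mul, hmass]
  -- (3′) the `G`-side with THIS constant (★ F2)
  have hB := classOrbitalIntegral_eq_smul_orbitalIntegral_levi_of_split_of_eq_smul_map (IsCMField.complexConj L) 3 H' hc hH' w hw hH'w
    νG mG (Measure.map jj νH) κ μU hcanG (Measure.map e' νG') (by rw [he', hνG']) hqC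
  -- (4) the weight `ψ` and the transfer map
  let ψ : ↥(standardLeviGL (w.1.adicCompletion L) (fun i : Fin (2 + 1) => decide (2 ≤ (i : ℕ)))) → ℂ := fun m =>
    (((C : ℝ≥0∞)).toReal : ℂ) *
        (fun u : (w.1.adicCompletion L)ˣ => ((μ.localComponent w.1 u : ℂˣ) : ℂ))
          (Matrix.GeneralLinearGroup.det (leviProjection (w.1.adicCompletion L) (fun i : Fin (2 + 1) => decide (2 ≤ (i : ℕ)))
            ⟨(m : GL (Fin (2 + 1)) (w.1.adicCompletion L)), standardLeviGL_le (w.1.adicCompletion L) _ m.2⟩ false)) *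
      ((Real.sqrt ((normAbs (w.1.adicCompletion L) (Matrix.of fun q q' : {i : Fin (2 + 1) // (fun i : Fin (2 + 1) => decide (2 ≤ (i : ℕ))) i = false} ×
            {j : Fin (2 + 1) // (fun i : Fin (2 + 1) => decide (2 ≤ (i : ℕ))) j = true} =>
          (((⟨(m : GL (Fin (2 + 1)) (w.1.adicCompletion L)), standardLeviGL_le (w.1.adicCompletion L) _ m.2⟩ :
              ↥(standardParabolicGL (w.1.adicCompletion L) (fun i : Fin (2 + 1) => decide (2 ≤ (i : ℕ))))) :
              GL (Fin (2 + 1)) (w.1.adicCompletion L)) : Matrix (Fin (2 + 1)) (Fin (2 + 1)) (w.1.adicCompletion L)) q.1 q'.1 *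
            ((((⟨(m : GL (Fin (2 + 1)) (w.1.adicCompletion L)), standardLeviGL_le (w.1.adicCompletion L) _ m.2⟩ :
              ↥(standardParabolicGL (w.1.adicCompletion L) (fun i : Fin (2 + 1) => decide (2 ≤ (i : ℕ)))))⁻¹ :
              standardParabolicGL (w.1.adicCompletion L) (fun i : Fin (2 + 1) => decide (2 ≤ (i : ℕ)))) :
              GL (Fin (2 + 1)) (w.1.adicCompletion L)) : Matrix (Fin (2 + 1)) (Fin (2 + 1)) (w.1.adicCompletion L)) q'.2 q.2).det : ℝ≥0) : ℝ) : ℝ) : ℂ)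
  let gφ : ((UnitaryGroup.cmDatum L 3 H').Local v → ℂ) →
      ↥(standardLeviGL (w.1.adicCompletion L) (fun i : Fin (2 + 1) => decide (2 ≤ (i : ℕ)))) → ℂ := fun φ m =>
    ∫ q' : ↥(glInt (2 + 1) (w.1.adicCompletion L)) × ↥(unipotentRadicalGL (w.1.adicCompletion L) (fun i : Fin (2 + 1) => decide (2 ≤ (i : ℕ)))),
      φ (e'.symm ((q'.1 : GL (Fin (2 + 1)) (w.1.adicCompletion L)) * ((m : GL (Fin (2 + 1)) (w.1.adicCompletion L)) *
        (q'.2 : GL (Fin (2 + 1)) (w.1.adicCompletion L))) * (q'.1 : GL (Fin (2 + 1)) (w.1.adicCompletion L))⁻¹)) ∂(κ.prod μU)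
  have hψconj : ∀ y m, ψ (y * m * y⁻¹) = ψ m := fun y m =>
    levi_weight_det_leviProjection_conj_eq (w.1.adicCompletion L) (fun i : Fin (2 + 1) => decide (2 ≤ (i : ℕ)))
      (fun u : (w.1.adicCompletion L)ˣ => ((μ.localComponent w.1 u : ℂˣ) : ℂ)) false (((C : ℝ≥0∞)).toReal : ℂ) m y
  have hψlc : IsLocallyConstant ψ :=
    isLocallyConstant_levi_weight_det_leviProjection (w.1.adicCompletion L) (fun i : Fin (2 + 1) => decide (2 ≤ (i : ℕ)))
      (μ.isLocallyConstant_localComponent_coe w.1) false (((C : ℝ≥0∞)).toReal : ℂ)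
  -- (4′) THE BRIDGE: the named `cmSplitTransfer … f` IS `h ↦ ψ (jj h) · gφ f (jj h)` (label transport `lastBlockLabel 3 = [2 ≤ ·]`, `δ = ‖det K‖^{1∕2}`, `C = νG(K′)∕νH(K_H)`)
  have hbridge : UnitaryGroup.cmSplitTransfer L H' hH'c hH'd v w hw μ νH νG f = fun h => ψ (jj h) * gφ f (jj h) := by
    funext h
    -- the Levi point and its blocks
    obtain ⟨m, eI, j₀, -, -, hlev, hg0, -⟩ := exists_eq_leviEmbeddingP_blocks 2 (e₂ h.1) (e₁ h.2)
    have hjjh : ((jj h : ↥(standardLeviGL (w.1.adicCompletion L) (fun i : Fin (2 + 1) => decide (2 ≤ (i : ℕ))))) : GL (Fin (2 + 1)) (w.1.adicCompletion L)) =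
        ((leviEmbeddingP (w.1.adicCompletion L) (fun i : Fin (2 + 1) => decide (2 ≤ (i : ℕ))) m :
          ↥(standardParabolicGL (w.1.adicCompletion L) (fun i : Fin (2 + 1) => decide (2 ≤ (i : ℕ))))) : GL (Fin (2 + 1)) (w.1.adicCompletion L)) := by
      rw [hjj, heM, hlev]
    have hincl : (⟨((jj h : ↥(standardLeviGL (w.1.adicCompletion L) (fun i : Fin (2 + 1) => decide (2 ≤ (i : ℕ))))) : GL (Fin (2 + 1)) (w.1.adicCompletion L)),
          standardLeviGL_le (w.1.adicCompletion L) _ (jj h).2⟩ :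
          ↥(standardParabolicGL (w.1.adicCompletion L) (fun i : Fin (2 + 1) => decide (2 ≤ (i : ℕ))))) =
        leviEmbeddingP (w.1.adicCompletion L) (fun i : Fin (2 + 1) => decide (2 ≤ (i : ℕ))) m := Subtype.ext hjjh
    -- (τ) the `false` block of `jj h` has determinant `det (e₂ h.1)`
    have hdet : Matrix.GeneralLinearGroup.det (leviProjection (w.1.adicCompletion L) (fun i : Fin (2 + 1) => decide (2 ≤ (i : ℕ)))
        (⟨((jj h : ↥(standardLeviGL (w.1.adicCompletion L) (fun i : Fin (2 + 1) => decide (2 ≤ (i : ℕ))))) : GL (Fin (2 + 1)) (w.1.adicCompletion L)),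
          standardLeviGL_le (w.1.adicCompletion L) _ (jj h).2⟩ :
          ↥(standardParabolicGL (w.1.adicCompletion L) (fun i : Fin (2 + 1) => decide (2 ≤ (i : ℕ))))) false) =
        Matrix.GeneralLinearGroup.det (UnitaryGroup.cmSplitEquivTwo L v w hw h.1) := by
      apply Units.ext
      rw [hincl, leviProjection_leviEmbeddingP_apply, Matrix.GeneralLinearGroup.val_det_apply, Matrix.GeneralLinearGroup.val_det_apply,
        ← Matrix.det_reindex_self eI, hg0, he₂D]
      rfl
    -- (δ) `‖det K_{jj h}‖^{1∕2} = δ_P^{1∕2}(cmSplitLeviGL h)` across the two spellings of the `(2,1)` labelling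
    have hδ : ((Real.sqrt ((normAbs (w.1.adicCompletion L) (Matrix.of fun q q' : {i : Fin (2 + 1) // (fun i : Fin (2 + 1) => decide (2 ≤ (i : ℕ))) i = false} ×
            {j : Fin (2 + 1) // (fun i : Fin (2 + 1) => decide (2 ≤ (i : ℕ))) j = true} =>
          (((⟨(jj h : GL (Fin (2 + 1)) (w.1.adicCompletion L)), standardLeviGL_le (w.1.adicCompletion L) _ (jj h).2⟩ :
              ↥(standardParabolicGL (w.1.adicCompletion L) (fun i : Fin (2 + 1) => decide (2 ≤ (i : ℕ))))) :
              GL (Fin (2 + 1)) (w.1.adicCompletion L)) : Matrix (Fin (2 + 1)) (Fin (2 + 1)) (w.1.adicCompletion L)) q.1 q'.1 *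
            ((((⟨(jj h : GL (Fin (2 + 1)) (w.1.adicCompletion L)), standardLeviGL_le (w.1.adicCompletion L) _ (jj h).2⟩ :
              ↥(standardParabolicGL (w.1.adicCompletion L) (fun i : Fin (2 + 1) => decide (2 ≤ (i : ℕ)))))⁻¹ :
              standardParabolicGL (w.1.adicCompletion L) (fun i : Fin (2 + 1) => decide (2 ≤ (i : ℕ)))) :
              GL (Fin (2 + 1)) (w.1.adicCompletion L)) : Matrix (Fin (2 + 1)) (Fin (2 + 1)) (w.1.adicCompletion L)) q'.2 q.2).det : ℝ≥0) : ℝ) : ℝ) : ℂ) =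
        ((rootDeltaChar (standardParabolicGL (w.1.adicCompletion L) (Zelevinsky1980.lastBlockLabel 3))
          ⟨UnitaryGroup.cmSplitLeviGL L v w hw h, UnitaryGroup.cmSplitLeviGL_mem_standardParabolicGL L v w hw h⟩ : ℂˣ) : ℂ) := by
      rw [rootDeltaChar_standardParabolicGL_eq_sqrt_normAbs_det_boxAd,
        normAbs_det_box_eq_of_label (w.1.adicCompletion L) UnitaryGroup.lastBlockLabel_three_eq]
      simp only [hjjGL]
      rfl
    -- (∫) the `K × U` integral across the two spellings of the labelling, and `e′`
    have hI : gφ f (jj h) = (letI : MeasurableSpace (GL (Fin 3) (w.1.adicCompletion L)) := borel _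
        ∫ q : ↥(glInt 3 (w.1.adicCompletion L)) × ↥(unipotentRadicalGL (w.1.adicCompletion L) (Zelevinsky1980.lastBlockLabel 3)),
          f (e'.symm
            ((q.1 : GL (Fin 3) (w.1.adicCompletion L)) * (UnitaryGroup.cmSplitLeviGL L v w hw h * (q.2 : GL (Fin 3) (w.1.adicCompletion L))) *
              (q.1 : GL (Fin 3) (w.1.adicCompletion L))⁻¹))
          ∂(UnitaryGroup.splitKUMeasure (w.1.adicCompletion L))) := by
      show (∫ q', f (e'.symm _) ∂(κ.prod μU)) = _
      simp only [hjjGL, hκ, hμU]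
      exact integral_KU_eq_of_label (w.1.adicCompletion L) UnitaryGroup.lastBlockLabel_three_eq.symm
        (fun x => f (e'.symm x)) (UnitaryGroup.cmSplitLeviGL L v w hw h)
    rw [UnitaryGroup.cmSplitTransfer_apply, UnitaryGroup.cmConstantTermSplit_apply, hI, ← hδ, ← hCreal, ← hdet]
    simp only [← he'D]
    show _ = ψ (jj h) * _
    ring
  refine ⟨?_, ?_⟩
  · -- `τ_v · f̄^P ∈ C_c^∞(H_v)` (★ (A1))
    rw [hbridge]
    exact isLocSmooth_mul_constantTerm_comp_twoOne (w.1.adicCompletion L) (κ.prod μU) (φ := fun y => f (e'.symm y))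
      (hf.isLocallyConstant.comp_continuous e'.symm.continuous) (hf.hasCompactSupport.comp_homeomorph e'.symm.toHomeomorph) hψlc jj
  · -- the identity per normalised matching pair `(γ_H, γ₀)`, `e′ γ₀ = endoGL (e₂ γ_H.1, e₁ γ_H.2)`
    rw [hbridge]
    refine isLocalDeltaTransfer_of_split_of_forall_pair L H' hc w hw hΦ₂ hΦ₂w hΦ₁ hΦ₁w hH' hH'w hΦ₂' hΦ₂d hΦ₁' hΦ₁d
      (finExplicitCollection L H' μ hl hr v) mH mG (fun h => ψ (jj h) * gφ f (jj h)) f ?_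
    intro γH hreg γ₀ h₀ he
    have hφ : IsLocSmooth f := hf
    rw [← he', ← he₂, ← he₁] at he
    -- (5) the Levi point `p = diag(e₂ γ_H.1, e₁ γ_H.2) = leviEmbeddingP c₀ m ∈ P ∩ M`, its conjugator `q`, regularity, the torus measure `ρ`
    have hregGL : IsRegularElt (endoGL (e₂ γH.1, e₁ γH.2)) := by
      have h := isRegularElt_endoGL_of_isLocalGRegular_of_split L hc w hw hΦ₂ hΦ₂w hΦ₁ hΦ₁w γH hreg
      rwa [← he₂, ← he₁] at h
    have hdet : (((e₂ γH.1 : GL (Fin 2) (w.1.adicCompletion L)) : Matrix (Fin 2) (Fin 2) (w.1.adicCompletion L)) -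
        (((e₁ γH.2 : GL (Fin 1) (w.1.adicCompletion L)) : Matrix (Fin 1) (Fin 1) (w.1.adicCompletion L)) 0 0) •
          (1 : Matrix (Fin 2) (Fin 2) (w.1.adicCompletion L))).det ≠ 0 :=
      det_sub_ne_zero_of_isRegularElt_endoGL (e₂ γH.1) (e₁ γH.2) hregGL
    obtain ⟨m, eI, j₀, hj₀, -, hlev, hg0, ht0⟩ := exists_eq_leviEmbeddingP_blocks 2 (e₂ γH.1) (e₁ γH.2)
    have hpM : ((leviEmbeddingP (w.1.adicCompletion L) (fun i : Fin (2 + 1) => decide (2 ≤ (i : ℕ))) m :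
        ↥(standardParabolicGL (w.1.adicCompletion L) (fun i : Fin (2 + 1) => decide (2 ≤ (i : ℕ))))) : GL (Fin (2 + 1)) (w.1.adicCompletion L)) ∈
          standardLeviGL (w.1.adicCompletion L) (fun i : Fin (2 + 1) => decide (2 ≤ (i : ℕ))) := ⟨m, rfl⟩
    obtain ⟨q, hq⟩ := isConj_iff.1 (isConj_endoGL_reindexGL_blockDiagGL (e₂ γH.1, e₁ γH.2))
    have hq' : q * localSplitEquiv (IsCMField.complexConj L) H' hc hH' w hw hH'w γ₀ * q⁻¹ =
        ((leviEmbeddingP (w.1.adicCompletion L) (fun i : Fin (2 + 1) => decide (2 ≤ (i : ℕ))) m :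
          ↥(standardParabolicGL (w.1.adicCompletion L) (fun i : Fin (2 + 1) => decide (2 ≤ (i : ℕ))))) : GL (Fin (2 + 1)) (w.1.adicCompletion L)) := by
      rw [← he', he, hq, hlev]
    have hTM : Subgroup.centralizer ({((leviEmbeddingP (w.1.adicCompletion L) (fun i : Fin (2 + 1) => decide (2 ≤ (i : ℕ))) m :
          ↥(standardParabolicGL (w.1.adicCompletion L) (fun i : Fin (2 + 1) => decide (2 ≤ (i : ℕ))))) : GL (Fin (2 + 1)) (w.1.adicCompletion L))} :
          Set (GL (Fin (2 + 1)) (w.1.adicCompletion L))) ≤ standardLeviGL (w.1.adicCompletion L) (fun i : Fin (2 + 1) => decide (2 ≤ (i : ℕ))) := by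
      rw [hlev]
      exact centralizer_le_standardLeviGL_of_det_sub_ne_zero 2 (e₂ γH.1) (e₁ γH.2) hdet
    have hp1 := det_one_sub_boxAd_ne_zero_of_det_sub_ne_zero 2 (e₂ γH.1) (e₁ γH.2) hdet
      (leviEmbeddingP (w.1.adicCompletion L) (fun i : Fin (2 + 1) => decide (2 ≤ (i : ℕ))) m) hlev
    have hreg₀ : IsRegularElt (γ₀.val : GL (Fin 3) (UnitaryGroup.LocalRing L v)) := isRegularElt_of_isLocalNormPair L H' v h₀ hreg
    have hsep : (((⟨((leviEmbeddingP (w.1.adicCompletion L) (fun i : Fin (2 + 1) => decide (2 ≤ (i : ℕ))) m :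
          ↥(standardParabolicGL (w.1.adicCompletion L) (fun i : Fin (2 + 1) => decide (2 ≤ (i : ℕ))))) : GL (Fin (2 + 1)) (w.1.adicCompletion L)), hpM⟩ :
          ↥(standardLeviGL (w.1.adicCompletion L) (fun i : Fin (2 + 1) => decide (2 ≤ (i : ℕ))))) : GL (Fin (2 + 1)) (w.1.adicCompletion L)) :
            Matrix (Fin (2 + 1)) (Fin (2 + 1)) (w.1.adicCompletion L)).charpoly.Separable := by
      have h1 := (isRegularElt_conj_iff q (endoGL (e₂ γH.1, e₁ γH.2))).2 hregGL
      rw [hq, ← hlev] at h1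
      exact h1
    obtain ⟨ρ, hρH, hρI, hρ1⟩ := exists_isHaarMeasure_compactCore_centralizer_subgroup_eq_one w.1
      (standardLeviGL (w.1.adicCompletion L) (fun i : Fin (2 + 1) => decide (2 ≤ (i : ℕ)))) hMc ⟨_, hpM⟩ hsep
    haveI := hρH
    haveI := hρI
    -- (6) the `G`-side (★ B5-R)
    have hR := hB γ₀ hreg₀ (leviEmbeddingP (w.1.adicCompletion L) (fun i : Fin (2 + 1) => decide (2 ≤ (i : ℕ))) m) hpM q hq' hTM hp1 ρ hρ1 f
      hφ.continuous hφ.hasCompactSupport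
    rw [← he', map_inv₀ (normAbs (w.1.adicCompletion L))] at hR
    -- (7) the `H`-side (★ B5-L)
    have hjjp : jj.toMulEquiv γH = ⟨((leviEmbeddingP (w.1.adicCompletion L) (fun i : Fin (2 + 1) => decide (2 ≤ (i : ℕ))) m :
        ↥(standardParabolicGL (w.1.adicCompletion L) (fun i : Fin (2 + 1) => decide (2 ≤ (i : ℕ))))) : GL (Fin (2 + 1)) (w.1.adicCompletion L)), hpM⟩ := by
      apply Subtype.ext
      show ((eM (e₂ γH.1, e₁ γH.2) : ↥(standardLeviGL (w.1.adicCompletion L) (fun i : Fin (2 + 1) => decide (2 ≤ (i : ℕ))))) :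
        GL (Fin (2 + 1)) (w.1.adicCompletion L)) = _
      rw [heM, hlev]
    have hP : IsLocalGRegular L v (Quotient.out (ConjClasses.mk γH)) := isLocalGRegular_out_mk hreg
    have hL := classOrbitalIntegral_eq_mul_orbitalIntegral_of_isCanonical_of_eq jj.toMulEquiv jj.continuous jj.symm.continuous hcanH γH hP
      (Measure.map jj νH) rfl hjjp ρ hρ1 ψ (fun y => hψconj y _) (gφ f) rfl
    -- (8) the scalar identity (★ PART 2 (a) + ★ B6)
    have hu : IsUnit ((finCharpolyTwo L v γH).eval (finGammaTwo L v γH)) := isUnit_eval_finCharpolyTwo_of_isLocalGRegular L v γH hreg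
    have hg' : Matrix.reindex eI eI ((m false : GL {i : Fin (2 + 1) // decide (2 ≤ (i : ℕ)) = false} (w.1.adicCompletion L)) :
          Matrix {i : Fin (2 + 1) // decide (2 ≤ (i : ℕ)) = false} {i : Fin (2 + 1) // decide (2 ≤ (i : ℕ)) = false} (w.1.adicCompletion L)) =
        (γH.1.val.val : Matrix (Fin 2) (Fin 2) (UnitaryGroup.LocalRing L v)).map (fun x => x w) := by
      rw [hg0, he₂]; rfl
    have ht' : ((m true : GL {j : Fin (2 + 1) // decide (2 ≤ (j : ℕ)) = true} (w.1.adicCompletion L)) :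
          Matrix {j : Fin (2 + 1) // decide (2 ≤ (j : ℕ)) = true} {j : Fin (2 + 1) // decide (2 ≤ (j : ℕ)) = true} (w.1.adicCompletion L)) j₀ j₀ =
        finGammaTwo L v γH w := by
      rw [ht0, he₁]; rfl
    have hunit : (isUnit_det_fst_map_apply L v γH w).unit = Matrix.GeneralLinearGroup.det (leviProjection (w.1.adicCompletion L)
        (fun i : Fin (2 + 1) => decide (2 ≤ (i : ℕ)))
        (⟨((leviEmbeddingP (w.1.adicCompletion L) (fun i : Fin (2 + 1) => decide (2 ≤ (i : ℕ))) m :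
            ↥(standardParabolicGL (w.1.adicCompletion L) (fun i : Fin (2 + 1) => decide (2 ≤ (i : ℕ))))) : GL (Fin (2 + 1)) (w.1.adicCompletion L)),
          standardLeviGL_le (w.1.adicCompletion L) _ hpM⟩ :
          ↥(standardParabolicGL (w.1.adicCompletion L) (fun i : Fin (2 + 1) => decide (2 ≤ (i : ℕ))))) false) := by
      apply Units.ext
      have hincl : (⟨((leviEmbeddingP (w.1.adicCompletion L) (fun i : Fin (2 + 1) => decide (2 ≤ (i : ℕ))) m :
            ↥(standardParabolicGL (w.1.adicCompletion L) (fun i : Fin (2 + 1) => decide (2 ≤ (i : ℕ))))) : GL (Fin (2 + 1)) (w.1.adicCompletion L)),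
          standardLeviGL_le (w.1.adicCompletion L) _ hpM⟩ :
          ↥(standardParabolicGL (w.1.adicCompletion L) (fun i : Fin (2 + 1) => decide (2 ≤ (i : ℕ))))) =
          leviEmbeddingP (w.1.adicCompletion L) (fun i : Fin (2 + 1) => decide (2 ≤ (i : ℕ))) m := Subtype.ext rfl
      rw [IsUnit.unit_spec, hincl, leviProjection_leviEmbeddingP_apply, Matrix.GeneralLinearGroup.val_det_apply, ← hg', Matrix.det_reindex_self]
    have hτ : finTau L v γH μ = (fun u : (w.1.adicCompletion L)ˣ => ((μ.localComponent w.1 u : ℂˣ) : ℂ))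
        (Matrix.GeneralLinearGroup.det (leviProjection (w.1.adicCompletion L) (fun i : Fin (2 + 1) => decide (2 ≤ (i : ℕ)))
          (⟨((leviEmbeddingP (w.1.adicCompletion L) (fun i : Fin (2 + 1) => decide (2 ≤ (i : ℕ))) m :
              ↥(standardParabolicGL (w.1.adicCompletion L) (fun i : Fin (2 + 1) => decide (2 ≤ (i : ℕ))))) : GL (Fin (2 + 1)) (w.1.adicCompletion L)),
            standardLeviGL_le (w.1.adicCompletion L) _ hpM⟩ :
            ↥(standardParabolicGL (w.1.adicCompletion L) (fun i : Fin (2 + 1) => decide (2 ≤ (i : ℕ))))) false)) := by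
      rw [finTau_eq_localComponent_det_of_split L v γH w μ hw hdual hu, hunit]
    have hA2 := finExplicitDelta_mul_toReal_eq_of_split L v γH w H' m eI j₀ hj₀ hw μ h₀ hu hg' ht' hp1 (C : ℝ≥0∞) hτ
    rw [norm_eq_coe_normAbs_adicCompletion'] at hA2
    -- (9) glue (★ PART 1 (G1))
    rw [finExplicitCollection_Δ]
    exact classOrbital_pair_identity_of_sides hL hR hA2

end Named

/-! ## §2 The closed statement in the frame of the registered stub -/

/-- **STUB (a) OF LINE «CMCharIdentityTest» ED. 5, CLOSED — [Rogawski1990, Lemma 4.13.1 (a)] at every split place, in the consumer's frame**: for every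
frame `(L, H, μ)` with the guards `hμu` (idle here), `hμω` (⇒ `hdual`, ★ `HeckeCharacter.galConj_eq_inv_of_restrict_eq_quadraticHeckeCharCM`), `hherm`,
`hanis`, Haar measures `νH v`, `νG v`, and every CANONICAL pair of orbital measure families `(mH, mG)`: at a place `v` split in `L` (witness ★
`splitWitness v hs`) and for every test `f` on `G′_v`, `cmSplitTransfer … f` is a test function on `H_v` and a `Δ‴_v`-transfer of `f` (§1 with every side
condition discharged as in ★ `localTransferExplicit_splitHalf`).  The binder frame is the registered stub's, token for token (quotient σ-algebras
`borel`), so the desk folds `stub_splitTransferIsTransfer := splitTransferIsTransfer` BY NAME.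
[cite: Rogawski1990, §4.13 Lemma 4.13.1 (a) pp. 64–66; §4.9 p. 55] -/
theorem splitTransferIsTransfer :
  ∀ (L : Type) [Field L] [NumberField L] [IsCMField L] (H : Matrix (Fin 3) (Fin 3) L) (μ : HeckeCharacter L)
    [∀ v : HeightOneSpectrum (𝓞 ↥(maximalRealSubfield L)), MeasurableSpace
      ((UnitaryGroup.cmDatum L 2 (Matrix.of fun i j : Fin 2 => if i.val + j.val + 1 = 2 then (1 : L) else 0)).Local v ×
        (UnitaryGroup.cmDatum L 1 (Matrix.of fun i j : Fin 1 => if i.val + j.val + 1 = 1 then (1 : L) else 0)).Local v)]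
    [∀ v : HeightOneSpectrum (𝓞 ↥(maximalRealSubfield L)), BorelSpace
      ((UnitaryGroup.cmDatum L 2 (Matrix.of fun i j : Fin 2 => if i.val + j.val + 1 = 2 then (1 : L) else 0)).Local v ×
        (UnitaryGroup.cmDatum L 1 (Matrix.of fun i j : Fin 1 => if i.val + j.val + 1 = 1 then (1 : L) else 0)).Local v)]
    [∀ v : HeightOneSpectrum (𝓞 ↥(maximalRealSubfield L)), MeasurableSpace ((UnitaryGroup.cmDatum L 3 H).Local v)]
    [∀ v : HeightOneSpectrum (𝓞 ↥(maximalRealSubfield L)), BorelSpace ((UnitaryGroup.cmDatum L 3 H).Local v)]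
    (νH : ∀ v : HeightOneSpectrum (𝓞 ↥(maximalRealSubfield L)), Measure
      ((UnitaryGroup.cmDatum L 2 (Matrix.of fun i j : Fin 2 => if i.val + j.val + 1 = 2 then (1 : L) else 0)).Local v ×
        (UnitaryGroup.cmDatum L 1 (Matrix.of fun i j : Fin 1 => if i.val + j.val + 1 = 1 then (1 : L) else 0)).Local v))
    (νG : ∀ v : HeightOneSpectrum (𝓞 ↥(maximalRealSubfield L)), Measure ((UnitaryGroup.cmDatum L 3 H).Local v))
    [∀ v, (νH v).IsHaarMeasure] [∀ v, (νH v).IsMulRightInvariant] [∀ v, (νG v).IsHaarMeasure] [∀ v, (νG v).IsMulRightInvariant]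
    (_hμu : μ.IsUnitary)
    (hμω : ∀ x : Literature.NumberTheory.GaloisRepresentations.ideleGroup ↥(maximalRealSubfield L),
      μ (AdeleRing.ideleBaseChange (↥(maximalRealSubfield L)) L x) = quadraticHeckeCharCM L x)
    (hherm : (H.map (cmConjRingHom L))ᵀ = H)
    (hanis : ∀ x : Fin 3 → L, Literature.AlgebraicGeometry.ShimuraVarieties.hermForm (cmConjRingHom L) H x x = 0 → x = 0),
    letI : ∀ (v : HeightOneSpectrum (𝓞 ↥(maximalRealSubfield L)))
        (a : (UnitaryGroup.cmDatum L 2 (Matrix.of fun i j : Fin 2 => if i.val + j.val + 1 = 2 then (1 : L) else 0)).Local v ×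
          (UnitaryGroup.cmDatum L 1 (Matrix.of fun i j : Fin 1 => if i.val + j.val + 1 = 1 then (1 : L) else 0)).Local v),
        MeasurableSpace (((UnitaryGroup.cmDatum L 2 (Matrix.of fun i j : Fin 2 => if i.val + j.val + 1 = 2 then (1 : L) else 0)).Local v ×
          (UnitaryGroup.cmDatum L 1 (Matrix.of fun i j : Fin 1 => if i.val + j.val + 1 = 1 then (1 : L) else 0)).Local v) ⧸
          Subgroup.centralizer ({a} : Set ((UnitaryGroup.cmDatum L 2 (Matrix.of fun i j : Fin 2 => if i.val + j.val + 1 = 2 then (1 : L) else 0)).Local v ×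
            (UnitaryGroup.cmDatum L 1 (Matrix.of fun i j : Fin 1 => if i.val + j.val + 1 = 1 then (1 : L) else 0)).Local v))) := fun _ _ => borel _
    haveI : ∀ (v : HeightOneSpectrum (𝓞 ↥(maximalRealSubfield L)))
        (a : (UnitaryGroup.cmDatum L 2 (Matrix.of fun i j : Fin 2 => if i.val + j.val + 1 = 2 then (1 : L) else 0)).Local v ×
          (UnitaryGroup.cmDatum L 1 (Matrix.of fun i j : Fin 1 => if i.val + j.val + 1 = 1 then (1 : L) else 0)).Local v),
        BorelSpace (((UnitaryGroup.cmDatum L 2 (Matrix.of fun i j : Fin 2 => if i.val + j.val + 1 = 2 then (1 : L) else 0)).Local v ×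
          (UnitaryGroup.cmDatum L 1 (Matrix.of fun i j : Fin 1 => if i.val + j.val + 1 = 1 then (1 : L) else 0)).Local v) ⧸
          Subgroup.centralizer ({a} : Set ((UnitaryGroup.cmDatum L 2 (Matrix.of fun i j : Fin 2 => if i.val + j.val + 1 = 2 then (1 : L) else 0)).Local v ×
            (UnitaryGroup.cmDatum L 1 (Matrix.of fun i j : Fin 1 => if i.val + j.val + 1 = 1 then (1 : L) else 0)).Local v))) := fun _ _ => ⟨rfl⟩
    letI : ∀ (v : HeightOneSpectrum (𝓞 ↥(maximalRealSubfield L))) (γ : (UnitaryGroup.cmDatum L 3 H).Local v),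
        MeasurableSpace ((UnitaryGroup.cmDatum L 3 H).Local v ⧸ Subgroup.centralizer ({γ} : Set ((UnitaryGroup.cmDatum L 3 H).Local v))) :=
      fun _ _ => borel _
    haveI : ∀ (v : HeightOneSpectrum (𝓞 ↥(maximalRealSubfield L))) (γ : (UnitaryGroup.cmDatum L 3 H).Local v),
        BorelSpace ((UnitaryGroup.cmDatum L 3 H).Local v ⧸ Subgroup.centralizer ({γ} : Set ((UnitaryGroup.cmDatum L 3 H).Local v))) :=
      fun _ _ => ⟨rfl⟩
    ∀ (mH : ∀ v : HeightOneSpectrum (𝓞 ↥(maximalRealSubfield L)), OrbitalMeasureFamily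
        ((UnitaryGroup.cmDatum L 2 (Matrix.of fun i j : Fin 2 => if i.val + j.val + 1 = 2 then (1 : L) else 0)).Local v ×
          (UnitaryGroup.cmDatum L 1 (Matrix.of fun i j : Fin 1 => if i.val + j.val + 1 = 1 then (1 : L) else 0)).Local v))
      (mG : ∀ v : HeightOneSpectrum (𝓞 ↥(maximalRealSubfield L)), OrbitalMeasureFamily ((UnitaryGroup.cmDatum L 3 H).Local v)),
      (∀ v : HeightOneSpectrum (𝓞 ↥(maximalRealSubfield L)), (mH v).IsCanonical (IsLocalGRegular L v) (νH v) ∧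
          (mG v).IsCanonical (fun γ => IsRegularElt (γ.val : GL (Fin 3) (UnitaryGroup.LocalRing L v))) (νG v)) →
      ∀ (v : HeightOneSpectrum (𝓞 ↥(maximalRealSubfield L))) (hs : ∃ w : PlacesOver L v, IsCMField.complexConj L • w.1 ≠ w.1)
        (f : (UnitaryGroup.cmDatum L 3 H).Local v → ℂ), IsLocSmooth f →
        IsLocSmooth (cmSplitTransfer L H hherm (isUnit_iff_ne_zero.mpr (Godement.det_ne_zero_of_anisotropic L H hanis)) v (splitWitness v hs)
            (splitWitness_spec v hs) μ (νH v) (νG v) f) ∧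
          IsLocalDeltaTransfer L H v ((finExplicitCollection L H μ (finExplicitDelta_conj_left_all L H μ) (finExplicitDelta_conj_right_all L H μ)) v) (mH v) (mG v)
            (cmSplitTransfer L H hherm (isUnit_iff_ne_zero.mpr (Godement.det_ne_zero_of_anisotropic L H hanis)) v (splitWitness v hs)
            (splitWitness_spec v hs) μ (νH v) (νG v) f) f := by
  intro L _ _ _ H μ _ _ _ _ νH νG _ _ _ _ _hμu hμω hherm hanis mH mG hcan v hs f hf
  letI : MeasurableSpace ((splitWitness v hs).1.adicCompletion L) := borel _
  haveI : BorelSpace ((splitWitness v hs).1.adicCompletion L) := ⟨rfl⟩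
  have hΦ₂d : (Matrix.of fun i j : Fin 2 => if i.val + j.val + 1 = 2 then (1 : L) else 0).det ≠ 0 := by
    have h : (Matrix.of fun i j : Fin 2 => if i.val + j.val + 1 = 2 then (1 : L) else 0) = !![0, 1; 1, 0] := by
      ext i j; fin_cases i <;> fin_cases j <;> rfl
    rw [h, Matrix.det_fin_two_of]; norm_num
  have hΦ₁d : (Matrix.of fun i j : Fin 1 => if i.val + j.val + 1 = 1 then (1 : L) else 0).det ≠ 0 := by
    rw [Matrix.det_fin_one, Matrix.of_apply]; norm_num
  have hΦ₂' : ((Matrix.of fun i j : Fin 2 => if i.val + j.val + 1 = 2 then (1 : L) else 0).map (cmConjRingHom L))ᵀ =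
      Matrix.of fun i j : Fin 2 => if i.val + j.val + 1 = 2 then (1 : L) else 0 := by
    rw [UnitaryGroup.map_cmConjRingHom_eq_map_complexConj]; exact UnitaryGroup.antidiagOne_map_transpose (IsCMField.complexConj L) 2
  have hΦ₁' : ((Matrix.of fun i j : Fin 1 => if i.val + j.val + 1 = 1 then (1 : L) else 0).map (cmConjRingHom L))ᵀ =
      Matrix.of fun i j : Fin 1 => if i.val + j.val + 1 = 1 then (1 : L) else 0 := by
    rw [UnitaryGroup.map_cmConjRingHom_eq_map_complexConj]; exact UnitaryGroup.antidiagOne_map_transpose (IsCMField.complexConj L) 1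
  -- the quotient σ-algebras of the frame are `borel` (inlined), not Mathlib's `QuotientGroup.measurableSpace`: pass them by unification `(_)`
  exact @isLocalDeltaTransfer_cmSplitTransfer L _ _ _ H v (IsCMField.complexConj_ne_one L) (splitWitness v hs) (splitWitness_spec v hs)
    (UnitaryGroup.antidiagOne_map_transpose (IsCMField.complexConj L) 2) (UnitaryGroup.isUnit_placeForm_antidiagOne (E := L) 2 (splitWitness v hs).1)
    (UnitaryGroup.antidiagOne_map_transpose (IsCMField.complexConj L) 1) (UnitaryGroup.isUnit_placeForm_antidiagOne (E := L) 1 (splitWitness v hs).1)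
    ((UnitaryGroup.map_cmConjRingHom_eq_map_complexConj L H) ▸ hherm)
    (UnitaryGroup.isUnit_placeForm_of_isUnit_det (isUnit_iff_ne_zero.mpr (Godement.det_ne_zero_of_anisotropic L H hanis)) (splitWitness v hs).1)
    hΦ₂' hΦ₂d hΦ₁' hΦ₁d _ _ _ _ _ _ (_) (_) (_) (_) μ (finExplicitDelta_conj_left_all L H μ) (finExplicitDelta_conj_right_all L H μ)
    (HeckeCharacter.galConj_eq_inv_of_restrict_eq_quadraticHeckeCharCM L μ hμω) (νH v) _ _ (νG v) _ _ (mH v) (mG v) (hcan v).1 (hcan v).2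
    hherm (isUnit_iff_ne_zero.mpr (Godement.det_ne_zero_of_anisotropic L H hanis)) f hf

end Literature.NumberTheory.Rogawski1990

end
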